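import Mathlib
import HarnessLib
import Summits.HubbardSuperconductivity.HubbardSuperconductivity.Theorems.KLProgrammeKLRegimeEngineFlowPieceIncrementData
import Summits.HubbardSuperconductivity.HubbardSuperconductivity.Theorems.KLProgrammeKLRegimeSectorSliceFamilyDefectFrames

/-!
# K3 VL child `KLRegimeVolumeLimitV17F2` (stmt-HubbardSuperconductivity-20440), located item #23 «W2-HALF-VL», brick «W2H-OVL» part 7 (PIECE DATA):
# the band increment of one RAW flow step `ν_m = e_{K_{m+1}} − e_{K_m}` on `Fin 2 → ℝ`, its smoothness and its four sup-jets in the two-scale class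
# `(G₀/x², G₁/x, G₂, G₃·x)`, `x = 4^m` — the `hνs / hN₀ … hN₃` binders of `norm_fwdDiff_iter_{space,time,tangent}_thinIncrPair_le` and the `hν` of
# `klAnisoIncr_mul_klAniso_eq_symbol`, for both signs

Cell `gate-hubbard-kl`, seat p3 (g14), lead of #23.  k3c3-p2's `flowPiece_increment_data` (`…EngineFlowPieceIncrementData`, p8-era) gives the increment and its
jets on `Momentum` from (I-F jets) `FlowPieceJetsAt L M β U μ R m`; the increment-pair instances read the piece on `Fin 2 → ℝ` through `WithLp.toLp`, which costs
`2^j` at order `j` (`norm_iteratedFDeriv_comp_toLp_le`, `…SectorSliceFamilyDefectFrames`).  With `G_j := R.Gfr j · uPow j U` (`uPow 0 U = |U|`, `uPow j U = U²`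
for `j ≥ 1`) and `x = 4^m`:

* **`thinIncr_flowPieceData`** — for `ν p = e_{K_{m+1}}(toLp p) − e_{K_m}(toLp p)`: `ContDiff ℝ 3 ν`, `|ν| ≤ G₀/x²`, `‖Dν‖ ≤ 2G₁/x`, `‖D²ν‖ ≤ 4G₂`,
  `‖D³ν‖ ≤ 8G₃·x`;
* **`thinIncr_flowPieceData_neg`** — the same four bounds for `−ν` (the base-`K_{m+1}` term of the split reads `e_{K_m} − e_{K_{m+1}}`).

The transfer telescope of #23 runs on the RAW flow frames `klFlowFrameU … m` (HOME/p3/g14/W2H-OVL-SPEC.md §2 (T9)).  Everything is proved; no definitions, no sorry.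
Nothing asserts any stub, K3, VL or superconductivity. [cite: BenfattoGiulianiMastropietro2006, §2.7 (2.71a), §3 (3.2)–(3.8)]
-/

noncomputable section

namespace Summit.HubbardSuperconductivity.HubbardSuperconductivity.Theorems.TorusFourierL2

set_option linter.dupNamespace false -- summit = problem name (single-conjunct summit), D-0017

open Literature.MathematicalPhysics.QuantumLattice Literature.Probability.LatticeModels
open Summit.HubbardSuperconductivity.HubbardSuperconductivity.Theorems.DispersionFlow
open Summit.HubbardSuperconductivity.HubbardSuperconductivity.Theorems.KLRegimeSplit
open Summit.HubbardSuperconductivity.HubbardSuperconductivity.Theorems.PerturbedFermiCurve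
open Summit.HubbardSuperconductivity.HubbardSuperconductivity.Theorems.EngineV8
open scoped Real

variable {L M : ℕ} [NeZero L] [NeZero M]

/-- **The raw flow-piece increment on `Fin 2 → ℝ`: smoothness and sup-jets in the two-scale class** (see the module docstring).
[cite: BenfattoGiulianiMastropietro2006, §2.7 (2.71a), §3 (3.2)] -/
theorem thinIncr_flowPieceData {β U μ : ℝ} {R : RenConsts} {m : ℕ} (hJ : FlowPieceJetsAt L M β U μ R m)
    {ν : (Fin 2 → ℝ) → ℝ}
    (hν : ∀ p, ν p = frameLevel μ (klFlowFrameU L M β U μ (m + 1)) (WithLp.toLp 2 p) - frameLevel μ (klFlowFrameU L M β U μ m) (WithLp.toLp 2 p))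
    {x : ℝ} (hx : x = (4 : ℝ) ^ m) :
    ContDiff ℝ 3 ν ∧ (∀ p, |ν p| ≤ R.Gfr 0 * uPow 0 U / x ^ 2) ∧ (∀ p, ‖fderiv ℝ ν p‖ ≤ 2 * (R.Gfr 1 * uPow 1 U) / x) ∧
      (∀ p, ‖iteratedFDeriv ℝ 2 ν p‖ ≤ 4 * (R.Gfr 2 * uPow 2 U)) ∧ (∀ p, ‖iteratedFDeriv ℝ 3 ν p‖ ≤ 8 * (R.Gfr 3 * uPow 3 U) * x) := by
  have hx0 : 0 < x := by rw [hx]; positivity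
  -- the increment on `Momentum` and its jets
  set f : Momentum → ℝ := fun q => frameLevel μ (klFlowFrameU L M β U μ (m + 1)) q - frameLevel μ (klFlowFrameU L M β U μ m) q with hf
  have hfC : ∀ {n : WithTop ℕ∞}, ContDiff ℝ n f := fun {n} =>
    (contDiff_frameLevel μ (klFlowFrameU L M β U μ (m + 1))).sub (contDiff_frameLevel μ (klFlowFrameU L M β U μ m))
  have hνf : ν = fun p : Fin 2 → ℝ => f (WithLp.toLp 2 p) := funext fun p => by rw [hν p]
  obtain ⟨h0, h1, h2, h3⟩ := flowPiece_increment_data (L := L) (M := M) (μ := μ) hJ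
  -- the exponents
  have e0 : (4 : ℝ) ^ ((((0 : ℕ) : ℤ) - 2) * (m : ℤ)) = 1 / x ^ 2 := by
    rw [hx, Nat.cast_zero, zero_sub, show (-2 : ℤ) * (m : ℤ) = -((m * 2 : ℕ) : ℤ) by push_cast; ring, zpow_neg, zpow_natCast, pow_mul, one_div]
  have e1 : (4 : ℝ) ^ ((((1 : ℕ) : ℤ) - 2) * (m : ℤ)) = 1 / x := by
    rw [hx, Nat.cast_one, show ((1 : ℤ) - 2) * (m : ℤ) = -(m : ℤ) by ring, zpow_neg, zpow_natCast, one_div]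
  have e2 : (4 : ℝ) ^ ((((2 : ℕ) : ℤ) - 2) * (m : ℤ)) = 1 := by rw [Nat.cast_ofNat, sub_self, zero_mul, zpow_zero]
  have e3 : (4 : ℝ) ^ ((((3 : ℕ) : ℤ) - 2) * (m : ℤ)) = x := by
    rw [hx, Nat.cast_ofNat, show ((3 : ℤ) - 2) * (m : ℤ) = (m : ℤ) by ring, zpow_natCast]
  have hC : ContDiff ℝ 3 ν := by rw [hνf]; exact hfC.comp (PiLp.contDiff_toLp)
  refine ⟨hC, fun p => ?_, fun p => ?_, fun p => ?_, fun p => ?_⟩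
  · have h := h0 (WithLp.toLp 2 p)
    rw [e0] at h
    rw [hν p]
    refine h.trans_eq ?_
    field_simp
  · have hb : ∀ q : Momentum, ‖iteratedFDeriv ℝ 1 f q‖ ≤ R.Gfr 1 * uPow 1 U / x := fun q => by
      rw [norm_iteratedFDeriv_one]; have h := h1 q; rw [e1] at h; refine h.trans_eq ?_; field_simp
    have h := norm_iteratedFDeriv_comp_toLp_le (hfC (n := 1)) hb p
    rw [norm_iteratedFDeriv_one, ← hνf] at h
    refine h.trans_eq ?_
    ring
  · have hb : ∀ q : Momentum, ‖iteratedFDeriv ℝ 2 f q‖ ≤ R.Gfr 2 * uPow 2 U := fun q => by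
      have h := h2 q; rw [e2, mul_one] at h; exact h
    have h := norm_iteratedFDeriv_comp_toLp_le (hfC (n := 2)) hb p
    rw [← hνf] at h
    refine h.trans_eq ?_
    ring
  · have hb : ∀ q : Momentum, ‖iteratedFDeriv ℝ 3 f q‖ ≤ R.Gfr 3 * uPow 3 U * x := fun q => by
      have h := h3 q; rw [e3] at h; exact h
    have h := norm_iteratedFDeriv_comp_toLp_le (hfC (n := 3)) hb p
    rw [← hνf] at h
    refine h.trans_eq ?_
    ring

/-- **The same data for the opposite sign** `−ν = e_{K_m} − e_{K_{m+1}}` (the jets are even in the sign). [cite: BenfattoGiulianiMastropietro2006, §3 (3.2)] -/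
theorem thinIncr_flowPieceData_neg {β U μ : ℝ} {R : RenConsts} {m : ℕ} (hJ : FlowPieceJetsAt L M β U μ R m)
    {ν : (Fin 2 → ℝ) → ℝ}
    (hν : ∀ p, ν p = frameLevel μ (klFlowFrameU L M β U μ m) (WithLp.toLp 2 p) - frameLevel μ (klFlowFrameU L M β U μ (m + 1)) (WithLp.toLp 2 p))
    {x : ℝ} (hx : x = (4 : ℝ) ^ m) :
    ContDiff ℝ 3 ν ∧ (∀ p, |ν p| ≤ R.Gfr 0 * uPow 0 U / x ^ 2) ∧ (∀ p, ‖fderiv ℝ ν p‖ ≤ 2 * (R.Gfr 1 * uPow 1 U) / x) ∧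
      (∀ p, ‖iteratedFDeriv ℝ 2 ν p‖ ≤ 4 * (R.Gfr 2 * uPow 2 U)) ∧ (∀ p, ‖iteratedFDeriv ℝ 3 ν p‖ ≤ 8 * (R.Gfr 3 * uPow 3 U) * x) := by
  -- `ν = −ν⁺`
  set νp : (Fin 2 → ℝ) → ℝ := fun p =>
    frameLevel μ (klFlowFrameU L M β U μ (m + 1)) (WithLp.toLp 2 p) - frameLevel μ (klFlowFrameU L M β U μ m) (WithLp.toLp 2 p) with hνp
  obtain ⟨hC, h0, h1, h2, h3⟩ := thinIncr_flowPieceData (L := L) (M := M) hJ (ν := νp) (fun p => rfl) hx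
  have hneg : ν = -νp := funext fun p => by rw [hν p, Pi.neg_apply, hνp]; ring
  refine ⟨by rw [hneg]; exact hC.neg, fun p => ?_, fun p => ?_, fun p => ?_, fun p => ?_⟩
  · rw [hneg, Pi.neg_apply, abs_neg]; exact h0 p
  · rw [hneg, fderiv_neg, norm_neg]; exact h1 p
  · rw [hneg, iteratedFDeriv_neg_apply, norm_neg]; exact h2 p
  · rw [hneg, iteratedFDeriv_neg_apply, norm_neg]; exact h3 p

end Summit.HubbardSuperconductivity.HubbardSuperconductivity.Theorems.TorusFourierL2

end
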